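import Literature.AnabelianGeometry.SemiGraphs.TieBijective
import Literature.AnabelianGeometry.SemiGraphs.CoveringGraphPointLift

/-!
# The TIE as an isomorphism of semi-graphs `ℋ.graph ⥲ 𝔾_A` over `𝕂` ([SemiAnbd] Def. 2.2 (i) p. 23)

Mochizuki, *Semi-graphs of anabelioids*, Publ. RIMS **42** (2006) 221–322, §2, Def. 2.2 (i) p. 23: the
finite étale covering `ℋ → 𝒦` attached to `A ∈ B(𝒦)` "lies over some proper morphism of semi-graphs: the
vertices (respectively, edges) of `𝔾′` that lie over a vertex `v` (respectively, an edge `e`) correspond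
to the connected components of `S_v` (respectively, `T_e`)" [cite: MochizukiSemiAnbd2006, Def. 2.2(i) p.23].

PROOF-ONLY corollary (abc-iut cell, layer L3; FACT-LIST row F-1478 `remark_2_4_1_covering`, brick (T-δ)
of `HOME/staging/f/f-161/J1-TIE-ROUTE.md`, the form Route T / (J1) and the bridge law L1 consume; seat
abc-iut-f-161).  `TieBijective.tie_bijective` packaged: for a four-clause covering `ψ : ℋ → 𝒦` of
connected semi-graphs of anabelioids attached to `A`, the canonical labels are the vertex and edge maps
of an ISOMORPHISM of semi-graphs `Θ : ℋ.graph ≅ 𝔾_A` (`𝔾_A = A.coveringGraph.graph`, abc-iut-L3-t5) OVER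
`𝕂` (`Θ ≫ proj = ψ.base`):

* `SemiGraph.Hom.branchMap_bijective_of_edgeMap_bijective` — a morphism of semi-graphs bijective on
  edges is bijective on branches;
* `Hom.exists_graphIso_over` — the isomorphism, with its vertex/edge maps given by the labels `O(w)`,
  `O(e′)` characterised by the factorisation of the tautological section `g = αψ(η_{𝟙_A}) ≫ e_ψ⁻¹_A`.

No `def`, no new `Prop`; nothing here takes a side on [IUTchIII] Cor. 3.12.
-/

namespace Literature.AnabelianGeometry.SemiGraphs

open CategoryTheory CategoryTheory.Limits

universe v₁ u₁ u

/-! ### Bijective on edges ⇒ bijective on branches -/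

namespace SemiGraph

variable {G G' : SemiGraph.{u}}

/-- A morphism of semi-graphs which is bijective on edges is bijective on branches (each edge has
exactly two branches, mapped injectively onto the two branches of its image, [SemiAnbd] §1 p. 11).
[cite: MochizukiSemiAnbd2006, §1 p.11] -/
theorem Hom.branchMap_bijective_of_edgeMap_bijective (φ : G ⟶ G') (he : Function.Bijective φ.edgeMap) :
    Function.Bijective φ.branchMap := by
  refine ⟨fun b₁ b₂ h => φ.branchMap_injOn b₁ b₂ (he.1 ?_) h, fun c => ?_⟩
  · rw [← φ.edgeOf_branchMap, ← φ.edgeOf_branchMap, h]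
  · obtain ⟨e, he'⟩ := he.2 (G'.edgeOf c)
    obtain ⟨b, -, hb⟩ := Hom.exists_branchMap_eq φ e c he'.symm
    exact ⟨b, hb⟩

end SemiGraph

/-! ### The isomorphism `ℋ.graph ≅ 𝔾_A` over `𝕂` -/

namespace SemiGraphOfAnabelioids

namespace Hom

open CategoryTheory.PreGaloisCategory Literature.AnabelianGeometry.Anabelioids

variable {ℋ 𝒦 : SemiGraphOfAnabelioids.{v₁, u₁, u}} (ψ : Hom ℋ 𝒦) (A : 𝒦.BObj)
  [HasBinaryProducts 𝒦.BObj] (αψ : Over A ⥤ ℋ.BObj) [αψ.IsEquivalence]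
  (eψ : ψ.pullbackFunctor ≅ Over.star A ⋙ αψ)

set_option backward.isDefEq.respectTransparency false in
/-- **The underlying semi-graph of a four-clause finite étale covering IS `𝔾_A`, over `𝕂`.**  For a
morphism `ψ : ℋ → 𝒦` of connected semi-graphs of anabelioids that is locally the covering attached to
`A` (`IsFiniteEtaleCoveringOf`), globally so through `αψ`, `e_ψ`, branch-aligned and vertex-aligned, there
are the canonical labels `O(w)`, `O(e′)` (the components of `A_{ψ w}`, `A_{ψ e′}` through which the
constituents of the tautological section `g = αψ(η_{𝟙_A}) ≫ e_ψ⁻¹_A` factor) and an isomorphism of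
semi-graphs `Θ : ℋ.graph ≅ 𝔾_A = A.coveringGraph.graph` lying over `ψ.base` (`Θ ≫ proj = ψ.base`) whose
vertex and edge maps are `w ↦ (ψ w, O w)`, `e′ ↦ (ψ e′, O e′)` (components shrunk into the universe of
the semi-graph, as in abc-iut-L3-t5's `BObj.fibreData`). [cite: MochizukiSemiAnbd2006, Def. 2.2(i) p.23] -/
theorem exists_graphIso_over (hloc : ψ.IsFiniteEtaleCoveringOf A) (hal : ψ.IsBranchAligned)
    (hva : ψ.IsVertexAligned) (hℋ : ℋ.IsConnected) (h𝒦 : 𝒦.IsConnected) :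
    ∃ (O : ∀ w : ℋ.graph.Vertex, π₀Obj (A.S (ψ.base.vertexMap w)))
      (OE : ∀ e' : ℋ.graph.Edge, π₀Obj (A.T (ψ.base.edgeMap e')))
      (Θ : ℋ.graph ≅ A.coveringGraph.graph),
      Θ.hom ≫ A.fibreData.proj = ψ.base ∧
      (∀ w, Θ.hom.vertexMap w = ⟨ψ.base.vertexMap w, equivShrink _ (O w)⟩) ∧
      (∀ e', Θ.hom.edgeMap e' = ⟨ψ.base.edgeMap e', equivShrink _ (OE e')⟩) ∧
      (∀ (w : ℋ.graph.Vertex) (P : π₀Obj (A.S (ψ.base.vertexMap w))),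
        P = O w ↔ ∃ k : (αψ.obj (Over.mk (𝟙 A))).S w ⟶
            (ψ.φV w).pullback.obj (P.1 : 𝒦.V (ψ.base.vertexMap w)),
          k ≫ (ψ.φV w).pullback.map P.1.arrow =
            (αψ.map ((Over.forgetAdjStar A).unit.app (Over.mk (𝟙 A))) ≫ eψ.inv.app A).fS w) ∧
      (∀ (e' : ℋ.graph.Edge) (Q : π₀Obj (A.T (ψ.base.edgeMap e'))),
        Q = OE e' ↔ ∃ k : (αψ.obj (Over.mk (𝟙 A))).T e' ⟶
            (ψ.φE e' (ψ.base.edgeMap e') rfl).pullback.obj (Q.1 : 𝒦.E (ψ.base.edgeMap e')),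
          k ≫ (ψ.φE e' (ψ.base.edgeMap e') rfl).pullback.map Q.1.arrow =
            (αψ.map ((Over.forgetAdjStar A).unit.app (Over.mk (𝟙 A))) ≫ eψ.inv.app A).fT e') := by
  obtain ⟨O, OE, hbV, hbE, h3, h4, h5⟩ := tie_bijective ψ A αψ eψ hloc hal hva hℋ h𝒦
  let D := A.fibreData
  let ℓV : ∀ w : ℋ.graph.Vertex, D.FV (ψ.base.vertexMap w) := fun w => equivShrink _ (O w)
  let ℓE : ∀ e' : ℋ.graph.Edge, D.FE (ψ.base.edgeMap e') := fun e' => equivShrink _ (OE e')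
  have hcast : ∀ {e₁ e₂ : 𝒦.graph.Edge} (h : e₁ = e₂) (Q : π₀Obj (A.T e₁)),
      cast (congrArg D.FE h) (equivShrink _ Q) = equivShrink _ (h ▸ Q : π₀Obj (A.T e₂)) := by
    intro e₁ e₂ h Q
    subst h
    rfl
  have hcompat : ∀ (b' : ℋ.graph.Branch) (w : ℋ.graph.Vertex) (h' : ℋ.graph.abuts b' = some w),
      D.σ (ψ.base.branchMap b') (ψ.base.vertexMap w) (ψ.base.abuts_branchMap b' w h')
        (cast (congrArg D.FE (ψ.base.edgeOf_branchMap b').symm) (ℓE (ℋ.graph.edgeOf b'))) = ℓV w := by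
    intro b' w h'
    change equivShrink _ (A.componentOver _ _ _
      ((equivShrink _).symm (cast _ (equivShrink _ (OE (ℋ.graph.edgeOf b')))))) = equivShrink _ (O w)
    rw [hcast (ψ.base.edgeOf_branchMap b').symm, Equiv.symm_apply_apply, h5 b' w h']
  obtain ⟨Θ₀, hΘ₀, hΘ₀V, hΘ₀E, -⟩ := D.exists_hom_total_of_labels ψ.base ℓV ℓE hcompat
  obtain ⟨hprop, -⟩ := hloc
  -- `Θ₀` is bijective on vertices, edges, branches and respects non-abutment (proper)
  have hv : Function.Bijective Θ₀.vertexMap := by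
    have hf : Θ₀.vertexMap = (Equiv.sigmaCongrRight fun u => equivShrink (π₀Obj (A.S u))) ∘
        (fun w : ℋ.graph.Vertex => (⟨ψ.base.vertexMap w, O w⟩ : Σ u, π₀Obj (A.S u))) :=
      funext fun w => hΘ₀V w
    rw [hf]
    exact (Equiv.bijective _).comp hbV
  have he : Function.Bijective Θ₀.edgeMap := by
    have hf : Θ₀.edgeMap = (Equiv.sigmaCongrRight fun e => equivShrink (π₀Obj (A.T e))) ∘
        (fun e' : ℋ.graph.Edge => (⟨ψ.base.edgeMap e', OE e'⟩ : Σ e, π₀Obj (A.T e))) :=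
      funext fun e' => hΘ₀E e'
    rw [hf]
    exact (Equiv.bijective _).comp hbE
  have hb : Function.Bijective Θ₀.branchMap :=
    SemiGraph.Hom.branchMap_bijective_of_edgeMap_bijective Θ₀ he
  have hn : ∀ b : ℋ.graph.Branch, ℋ.graph.abuts b = none →
      A.coveringGraph.graph.abuts (Θ₀.branchMap b) = none :=
    SemiGraph.IsProper.abuts_branchMap_eq_none Θ₀ (D.isProper_of_comp_proj_eq ψ.base hprop Θ₀ hΘ₀)
  exact ⟨O, OE, SemiGraph.Hom.isoOfBijective Θ₀ hv he hb hn, hΘ₀, hΘ₀V, hΘ₀E, h3, h4⟩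

end Hom

end SemiGraphOfAnabelioids

end Literature.AnabelianGeometry.SemiGraphs
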